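import Literature.NumberTheory.QuadraticFields.ClassNumberOneLandau
import HarnessLib

/-!
# The class number one problem for `D = −n`, `n ≡ 3 (mod 8)`: the small range `n ≤ 500000` by kernel search

Topic `NumberTheory/QuadraticFields`, namespace
`Literature.NumberTheory.QuadraticFields.BinaryQuadraticForm` (sub-namespace `SmallRange` for the
search functions). Everything here is PROVED (theorems and computable search functions only; no
named facts).

The Heegner–Stark theorem for primes `p ≡ 3 (mod 8)` (`HeegnerStarkPrimeThreeModEight`,
`ClassNumberOneGenus.lean`: `h(−p) = 1 ⟹ p ∈ {3, 11, 19, 43, 67, 163}`) is reduced in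
`ClassNumberOneBakerFundamental.lean` (`heegnerStarkPrimeThreeModEight_of_ranges`, Baker's route,
*Transcendental Number Theory* Ch. 5) to a *small range* `p ≤ P₀`, to be settled by enumeration,
and a *large range*. This file settles the small range up to `500000`
(`two_le_classNumber_of_le`, `heegnerStarkPrime_small`): for every `n ≡ 3 (mod 8)`,
`n ≤ 500000`, other than `3, 11, 19, 27, 43, 67, 163`, the kernel finds a reduced primitive form
`(a, b, c)` of discriminant `−n` with `a > 1` (`SmallRange.checkN`), so that `h(−n) ≥ 2` by
`two_le_classNumber_of_mem_reducedForms` (the principal form being reduced as well). The search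
is the obvious one (`a = 3, 5, 7, …` while `3a² ≤ n`; `b = 1, 3, …, ≤ a`; test `4a ∣ b² + n`,
`4a² ≤ b² + n`, `gcd(a, b, c) = 1`); it costs about `4.6` trials per `n` on average and never
needs `a > 47` in this range (checked outside Lean beforehand; inside Lean the kernel simply runs
it: `checkBlocks_eq_true`, by `decide +kernel`, in blocks of `100` values of `n`).

This is the finite computation at the bottom of every proof of the class number one theorem
(Cox, *Primes of the form x² + ny²*, Thm. 7.30(ii): the discriminants `D ≡ 5 (mod 8)` of class
number one are `−3, −11, −19, −27, −43, −67, −163`); in Baker's account (Ch. 5 §4, p. 51 of the held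
copy) the range below the transcendence bound is "quite feasible" to determine and was in fact
covered by the calculations of Stark (Trans. Amer. Math. Soc. 122 (1966), 112–19: a tenth field
would have `d > exp(10⁷)`). Here only `n ≤ 500000` is needed (the continued-fraction treatment of
the medium range takes over from there) and the kernel does it from first principles.

## References

* [Cox2013] D. A. Cox, *Primes of the form x² + ny²*, 2nd ed. (2013), §2.A Thm. 2.8, Thm. 2.13;
  §7.D Thm. 7.30.
* [Baker1975] A. Baker, *Transcendental Number Theory* (1975), Ch. 5 §§4–5.
-/

namespace Literature.NumberTheory.QuadraticFields.BinaryQuadraticForm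

namespace SmallRange

/-! ### The search -/

/-- The certificate test at `(n, a, b)`: with `c = (b² + n) / (4a)`, require `4a ∣ b² + n`,
`4a² ≤ b² + n` (i.e. `a ≤ c`) and `gcd(a, b, c) = 1`. [folklore] -/
def certOK (n a b : ℕ) : Bool :=
  ((b * b + n) % (4 * a) == 0) && Nat.ble (4 * a * a) (b * b + n) &&
    (Nat.gcd (Nat.gcd a b) ((b * b + n) / (4 * a)) == 1)

/-- Search over `b, b + 2, …` while `b ≤ a` (structural recursion on a fuel). [folklore] -/
def findB (n a : ℕ) : ℕ → ℕ → Bool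
  | 0, _ => false
  | fuel + 1, b => if a < b then false else (certOK n a b || findB n a fuel (b + 2))

/-- Search over `a, a + 2, …` while `3a² ≤ n` (structural recursion on a fuel). [folklore] -/
def findA (n : ℕ) : ℕ → ℕ → Bool
  | 0, _ => false
  | fuel + 1, a => if n < 3 * a * a then false else (findB n a (a + 1) 1 || findA n fuel (a + 2))

/-- The search for a reduced primitive form `(a, b, c)` of discriminant `−n` with `a ≥ 3`.
[folklore] -/
def checkN (n : ℕ) : Bool := findA n n 3

/-- The seven values `n ≡ 3 (mod 8)` with `h(−n) = 1` (Cox, Thm. 7.30: `−3, −11, −19, −27, −43,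
−67, −163`), skipped by the range check. [cite: Cox2013, §7.D Thm. 7.30(ii)] -/
def exceptional (n : ℕ) : Bool :=
  n == 3 || n == 11 || n == 19 || n == 27 || n == 43 || n == 67 || n == 163

/-- Check `n = 8(lo + j) + 3` for `j < len`. [folklore] -/
def checkBlock (lo : ℕ) : ℕ → Bool
  | 0 => true
  | len + 1 => (exceptional (8 * (lo + len) + 3) || checkN (8 * (lo + len) + 3)) && checkBlock lo len

/-- Check the blocks `[(k₀ + k)L, (k₀ + k + 1)L)` for `k < K`, i.e. all `n = 8i + 3`,
`k₀ L ≤ i < (k₀ + K) L`. [folklore] -/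
def checkBlocks (L k₀ : ℕ) : ℕ → Bool
  | 0 => true
  | k + 1 => checkBlock ((k₀ + k) * L) L && checkBlocks L k₀ k

/-! ### Correctness of the search -/

/-- A successful certificate test yields `h(−n) ≥ 2`: `(a, b, c)` is a reduced primitive positive
definite form of discriminant `−n` other than the principal form. [cite: Cox2013, §2.A Thm. 2.13] -/
theorem two_le_classNumber_of_certOK {n a b : ℕ} (hn : 0 < n) (ha : 1 < a) (hba : b ≤ a)
    (h : certOK n a b = true) : 2 ≤ classNumber (-(n : ℤ)) := by
  simp only [certOK, Bool.and_eq_true, beq_iff_eq, Nat.ble_eq] at h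
  obtain ⟨⟨hmod, hle⟩, hgcd⟩ := h
  set c := (b * b + n) / (4 * a) with hc
  have hmul : b * b + n = 4 * a * c := by
    rw [hc]; exact (Nat.div_mul_cancel (Nat.dvd_of_mod_eq_zero hmod)).symm.trans (by ring)
  have hac : a ≤ c := by
    by_contra hlt
    push Not at hlt
    have : 4 * a * c < 4 * a * a := Nat.mul_lt_mul_of_pos_left hlt (by omega)
    omega
  have hD : (-(n : ℤ)) < 0 := by omega
  have hmem : ((a : ℤ), (b : ℤ), (c : ℤ)) ∈ reducedForms (-(n : ℤ)) := by
    refine (mem_reducedForms_iff hD).2 ⟨?_, by simp only; omega, ?_, ?_⟩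
    · rw [discr_apply]
      have : ((b * b + n : ℕ) : ℤ) = ((4 * a * c : ℕ) : ℤ) := by rw [hmul]
      push_cast at this
      linarith
    · simp only [IsPrimitive, Int.gcd_natCast_natCast]
      exact hgcd
    · refine ⟨by simp only; omega, by simp only; omega, by simp only; omega, fun _ => by simp only; omega⟩
  refine two_le_classNumber_of_mem_reducedForms hD hmem fun heq => ?_
  have := congrArg Prod.fst heq
  rw [principalForm_fst] at this
  simp only at this
  omega

/-- Correctness of `findB`. [folklore] -/
theorem two_le_classNumber_of_findB {n a : ℕ} (hn : 0 < n) (ha : 1 < a) :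
    ∀ fuel b, findB n a fuel b = true → 2 ≤ classNumber (-(n : ℤ))
  | 0, _, h => by simp [findB] at h
  | fuel + 1, b, h => by
    unfold findB at h
    by_cases hab : a < b
    · simp [hab] at h
    · rw [if_neg hab, Bool.or_eq_true] at h
      rcases h with h | h
      · exact two_le_classNumber_of_certOK hn ha (not_lt.1 hab) h
      · exact two_le_classNumber_of_findB hn ha fuel (b + 2) h

/-- Correctness of `findA`. [folklore] -/
theorem two_le_classNumber_of_findA {n : ℕ} (hn : 0 < n) :
    ∀ fuel a, 1 < a → findA n fuel a = true → 2 ≤ classNumber (-(n : ℤ))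
  | 0, _, _, h => by simp [findA] at h
  | fuel + 1, a, ha, h => by
    unfold findA at h
    by_cases hna : n < 3 * a * a
    · simp [hna] at h
    · rw [if_neg hna, Bool.or_eq_true] at h
      rcases h with h | h
      · exact two_le_classNumber_of_findB hn ha (a + 1) 1 h
      · exact two_le_classNumber_of_findA hn fuel (a + 2) (by omega) h

/-- **Correctness of the search**: `checkN n = true ⟹ h(−n) ≥ 2`. [cite: Cox2013, §2.A Thm. 2.13] -/
theorem two_le_classNumber_of_checkN {n : ℕ} (hn : 0 < n) (h : checkN n = true) :
    2 ≤ classNumber (-(n : ℤ)) :=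
  two_le_classNumber_of_findA hn n 3 (by norm_num) h

/-- Correctness of `checkBlock`. [folklore] -/
theorem checkBlock_spec {lo : ℕ} :
    ∀ len, checkBlock lo len = true → ∀ j, j < len →
      exceptional (8 * (lo + j) + 3) = true ∨ checkN (8 * (lo + j) + 3) = true
  | 0, _, j, hj => absurd hj (Nat.not_lt_zero j)
  | len + 1, h, j, hj => by
    rw [checkBlock, Bool.and_eq_true, Bool.or_eq_true] at h
    rcases Nat.lt_succ_iff_lt_or_eq.1 hj with hj | rfl
    · exact checkBlock_spec len h.2 j hj
    · exact h.1

/-- Correctness of `checkBlocks`. [folklore] -/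
theorem checkBlocks_spec {L k₀ : ℕ} :
    ∀ K, checkBlocks L k₀ K = true → ∀ i, k₀ * L ≤ i → i < (k₀ + K) * L →
      exceptional (8 * i + 3) = true ∨ checkN (8 * i + 3) = true
  | 0, _, i, h0, hi => by rw [add_zero] at hi; omega
  | K + 1, h, i, h0, hi => by
    rw [checkBlocks, Bool.and_eq_true] at h
    by_cases hlt : i < (k₀ + K) * L
    · exact checkBlocks_spec K h.2 i h0 hlt
    · push Not at hlt
      obtain ⟨j, rfl⟩ := Nat.exists_eq_add_of_le hlt
      have hj : j < L := by rw [← add_assoc, Nat.succ_mul] at hi; omega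
      exact checkBlock_spec L h.1 j hj

/-! ### The kernel computation: all `n ≡ 3 (mod 8)`, `n < 8 · 62500 + 3 = 500003`

Five kernel runs (`decide +kernel`) of `12500` values of `n` each, in blocks of `100` (about `20 s`
of kernel time each). -/

/-- `0 ≤ i < 12500`. [folklore] -/
theorem checkBlocks_eq_true₀ : checkBlocks 100 0 125 = true := by decide +kernel

/-- `12500 ≤ i < 25000`. [folklore] -/
theorem checkBlocks_eq_true₁ : checkBlocks 100 125 125 = true := by decide +kernel

/-- `25000 ≤ i < 37500`. [folklore] -/
theorem checkBlocks_eq_true₂ : checkBlocks 100 250 125 = true := by decide +kernel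

/-- `37500 ≤ i < 50000`. [folklore] -/
theorem checkBlocks_eq_true₃ : checkBlocks 100 375 125 = true := by decide +kernel

/-- `50000 ≤ i < 62500`. [folklore] -/
theorem checkBlocks_eq_true₄ : checkBlocks 100 500 125 = true := by decide +kernel

/-- All `i < 62500`: `n = 8i + 3` is exceptional or certified. [folklore] -/
theorem exceptional_or_checkN {i : ℕ} (hi : i < 62500) :
    exceptional (8 * i + 3) = true ∨ checkN (8 * i + 3) = true := by
  by_cases h₁ : i < 12500
  · exact checkBlocks_spec 125 checkBlocks_eq_true₀ i (by omega) (by omega)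
  by_cases h₂ : i < 25000
  · exact checkBlocks_spec 125 checkBlocks_eq_true₁ i (by omega) (by omega)
  by_cases h₃ : i < 37500
  · exact checkBlocks_spec 125 checkBlocks_eq_true₂ i (by omega) (by omega)
  by_cases h₄ : i < 50000
  · exact checkBlocks_spec 125 checkBlocks_eq_true₃ i (by omega) (by omega)
  · exact checkBlocks_spec 125 checkBlocks_eq_true₄ i (by omega) (by omega)

end SmallRange

open SmallRange

/-- **The small range of the class number one problem for `D ≡ 5 (mod 8)`**: for
`n ≡ 3 (mod 8)`, `n ≤ 500000`, `n ∉ {3, 11, 19, 27, 43, 67, 163}`, one has `h(−n) ≥ 2`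
(Cox, Thm. 7.30(ii): the discriminants `D ≡ 5 (mod 8)` of class number one are
`−3, −11, −19, −27, −43, −67, −163`). [cite: Cox2013, §7.D Thm. 7.30(ii)] -/
theorem two_le_classNumber_of_le {n : ℕ} (h8 : n % 8 = 3) (hle : n ≤ 500000)
    (hex : n ∉ ({3, 11, 19, 27, 43, 67, 163} : Finset ℕ)) : 2 ≤ classNumber (-(n : ℤ)) := by
  obtain ⟨i, rfl⟩ : ∃ i, n = 8 * i + 3 := ⟨n / 8, by omega⟩
  rcases exceptional_or_checkN (show i < 62500 by omega) with h | h
  · exfalso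
    simp only [exceptional, Bool.or_eq_true, beq_iff_eq] at h
    simp only [Finset.mem_insert, Finset.mem_singleton] at hex
    omega
  · exact two_le_classNumber_of_checkN (by omega) h

/-- **The small range in the shape of `heegnerStarkPrimeThreeModEight_of_ranges`**: a prime
`p₀ ≡ 3 (mod 8)`, `p₀ ≤ 500000`, with `h(−p₀) = 1` is one of `3, 11, 19, 43, 67, 163`.
[cite: Cox2013, §7.D Thm. 7.30] -/
theorem heegnerStarkPrime_small (p₀ : ℕ) (hp : p₀.Prime) (h8 : p₀ % 8 = 3) (hle : p₀ ≤ 500000)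
    (h1 : classNumber (-(p₀ : ℤ)) = 1) : p₀ ∈ ({3, 11, 19, 43, 67, 163} : Finset ℕ) := by
  by_contra hmem
  have hex : p₀ ∉ ({3, 11, 19, 27, 43, 67, 163} : Finset ℕ) := by
    simp only [Finset.mem_insert, Finset.mem_singleton] at hmem ⊢
    have h27 : p₀ ≠ 27 := by rintro rfl; exact absurd hp (by norm_num)
    omega
  have := two_le_classNumber_of_le h8 hle hex
  omega

end Literature.NumberTheory.QuadraticFields.BinaryQuadraticForm
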